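import Summits.CriticalPhenomena.PercolationContinuityZ3.Theorems.Transplant.Slab111HubXLang
import HarnessLib

/-!
# The HUB ROUTING of the `(111)`-films, XXVII-X: the level conditions of the zone-free dispatcher as formulas, with soundness

builds on p205010 (kernel theorem, internal audit signed; external expert review pending) — NOT used in this file.  Lane `prim-bschramm`, seat
`prim-bschramm-p2` (gen 37; class C1b; memo `HOME/bschramm/P2-LATTICES.md` §135); helper file (`--supports stmt-CriticalPhenomena-4575 --as helper`).
Every level condition of a zone-free hub plan («Slab111HubXPlan».`HubPlanX`) compares two quantities of the form `nᵢ + u` (`nᵢ` a terminal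
level), or one of them with `0` / `k`.  §1 builds these comparisons as CUBES of «Slab111HubXLang» atoms (`ltQ`, `neQ`, `memQ`, `ltMinQ`,
`gtMaxQ`) and §2 proves their soundness at the pattern of a configuration: a true cube implies the real inequality (`ltQ_sound`, `neQ_sound`,
`memQ_sound`, …).  A level term is `(i, u)` with `i ∈ {1,2,3}` (`LvT`).
[cite: DuminilCopinSidoraviciusTassion2016, §2.3 (proof of Fact 2: the three disjoint paths γ_u, γ_v, γ_w in B_R(z))]
-/

namespace Summit.CriticalPhenomena.PercolationContinuityZ3.Theorems.Transplant

namespace Slab111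

/-! ## §1 Level terms and the comparison cubes -/

/-- A level term `nᵢ + u`: terminal index `i ∈ {1,2,3}` and offset `u`. [folklore] -/
abbrev LvT := ℕ × ℤ

/-- The value of a level term at levels `(n₁, n₂, n₃)`. [folklore] -/
def LvT.val (n₁ n₂ n₃ : ℤ) (A : LvT) : ℤ := (if A.1 = 1 then n₁ else if A.1 = 2 then n₂ else n₃) + A.2

/-- The atom `n_j − n_i > x` for distinct terminal indices. [folklore] -/
def dgtAtom (i j : ℕ) (x : ℤ) : Atom :=
  if i = 1 ∧ j = 2 then ⟨0, .dgt, x⟩ else if i = 1 ∧ j = 3 then ⟨1, .dgt, x⟩ else if i = 2 ∧ j = 3 then ⟨2, .dgt, x⟩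
  else if i = 2 ∧ j = 1 then ⟨0, .dlt, -x⟩ else if i = 3 ∧ j = 1 then ⟨1, .dlt, -x⟩ else ⟨2, .dlt, -x⟩

/-- The false cube and the true cube. [folklore] -/
def falseQ : List (List Atom) := [[]]

/-- **`A < B`** as a cube. [folklore] -/
def ltQ (A B : LvT) : List (List Atom) :=
  if A.1 = B.1 then (if A.2 < B.2 then [] else falseQ) else [[dgtAtom A.1 B.1 (A.2 - B.2)]]

/-- **`A ≠ B`** as a cube (one clause `A < B ∨ B < A`). [folklore] -/
def neQ (A B : LvT) : List (List Atom) :=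
  if A.1 = B.1 then (if A.2 ≠ B.2 then [] else falseQ) else [[dgtAtom A.1 B.1 (A.2 - B.2), dgtAtom B.1 A.1 (B.2 - A.2)]]

/-- `A < min Bs`. [folklore] -/
def ltMinQ (A : LvT) (Bs : List LvT) : List (List Atom) := Bs.flatMap fun B => ltQ A B
/-- `max Bs < A`. [folklore] -/
def gtMaxQ (A : LvT) (Bs : List LvT) : List (List Atom) := Bs.flatMap fun B => ltQ B A

/-- The bottom / top coordinate of terminal `i`. [folklore] -/
def botC (i : ℕ) : ℕ := if i = 1 then 3 else if i = 2 then 5 else 7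
/-- The top coordinate of terminal `i`. [folklore] -/
def topC (i : ℕ) : ℕ := if i = 1 then 4 else if i = 2 then 6 else 8

/-- `nᵢ + x ≥ 0`. [folklore] -/
def ge0A (i : ℕ) (x : ℤ) : Atom := ⟨botC i, .bge, x⟩
/-- `nᵢ + x ≤ k`. [folklore] -/
def leKA (i : ℕ) (x : ℤ) : Atom := ⟨topC i, .tle, x⟩
/-- `nᵢ + x ≠ 0`. [folklore] -/
def ne0A (i : ℕ) (x : ℤ) : Atom := ⟨botC i, .bne0, x⟩
/-- `nᵢ + x ≠ k`. [folklore] -/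
def neKA (i : ℕ) (x : ℤ) : Atom := ⟨topC i, .tnek, x⟩
/-- `nᵢ + x = 0`. [folklore] -/
def eq0A (i : ℕ) (x : ℤ) : Atom := ⟨botC i, .beq0, x⟩
/-- `nᵢ + x = k`. [folklore] -/
def eqKA (i : ℕ) (x : ℤ) : Atom := ⟨topC i, .teqk, x⟩

/-- **Membership cube** of the vertex at level `nᵢ + x` over a column with bottom/top badness flags `bb, bt`: level in `[0, k]`, and not a
bad boundary vertex. [folklore] -/
def memQ (i : ℕ) (x : ℤ) (bb bt : Bool) : List (List Atom) :=
  [[ge0A i x], [leKA i x]] ++ (if bb then [[ne0A i x]] else []) ++ (if bt then [[neKA i x]] else [])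

/-! ## §2 Soundness at the pattern of a configuration -/

section Sound

variable {n₁ n₂ n₃ k : ℤ} (h1 : 0 ≤ n₁ ∧ n₁ ≤ k) (h2 : 0 ≤ n₂ ∧ n₂ ≤ k) (h3 : 0 ≤ n₃ ∧ n₃ ≤ k)
include h1 h2 h3

/-- Soundness of `dgtAtom`: for `i ≠ j` in `{1,2,3}`, a true atom gives `n_j − n_i > x`. [folklore] -/
theorem dgtAtom_sound {i j : ℕ} (hi : i = 1 ∨ i = 2 ∨ i = 3) (hj : j = 1 ∨ j = 2 ∨ j = 3) (hij : i ≠ j) {x : ℤ}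
    (h : (dgtAtom i j x).eval (patOf n₁ n₂ n₃ k) = true) :
    x < LvT.val n₁ n₂ n₃ (j, 0) - LvT.val n₁ n₂ n₃ (i, 0) := by
  have key : ∀ a : Atom, a.ws = true → a.eval (patOf n₁ n₂ n₃ k) = true → a.Means (realOf n₁ n₂ n₃ k a.i) :=
    fun a hw he => a.sound hw h1 h2 h3 he
  unfold LvT.val
  unfold dgtAtom at h
  rcases hi with rfl | rfl | rfl <;> rcases hj with rfl | rfl | rfl <;> simp only [and_true, and_false, if_true, if_false,
    show ¬((1:ℕ) = 2) by omega, show ¬((1:ℕ) = 3) by omega, show ¬((2:ℕ) = 1) by omega, show ¬((2:ℕ) = 3) by omega,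
    show ¬((3:ℕ) = 1) by omega, show ¬((3:ℕ) = 2) by omega] at h hij ⊢ <;>
    first | exact absurd rfl hij | (have := key _ rfl h; unfold Atom.Means realOf at this; simp only at this; omega)

/-- Soundness of `ltQ`. [folklore] -/
theorem ltQ_sound {A B : LvT} (hA : A.1 = 1 ∨ A.1 = 2 ∨ A.1 = 3) (hB : B.1 = 1 ∨ B.1 = 2 ∨ B.1 = 3)
    (h : evalQ (patOf n₁ n₂ n₃ k) (ltQ A B) = true) : LvT.val n₁ n₂ n₃ A < LvT.val n₁ n₂ n₃ B := by
  unfold ltQ at h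
  by_cases he : A.1 = B.1
  · rw [if_pos he] at h
    by_cases hl : A.2 < B.2
    · unfold LvT.val; rw [he]; omega
    · rw [if_neg hl] at h; unfold falseQ evalQ evalC at h; simp at h
  · rw [if_neg he] at h
    unfold evalQ evalC at h
    simp only [List.all_cons, List.all_nil, List.any_cons, List.any_nil, Bool.or_false, Bool.and_true] at h
    have := dgtAtom_sound h1 h2 h3 hA hB he h
    unfold LvT.val at this ⊢; simp only [add_zero] at this; omega

/-- Soundness of `neQ`. [folklore] -/
theorem neQ_sound {A B : LvT} (hA : A.1 = 1 ∨ A.1 = 2 ∨ A.1 = 3) (hB : B.1 = 1 ∨ B.1 = 2 ∨ B.1 = 3)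
    (h : evalQ (patOf n₁ n₂ n₃ k) (neQ A B) = true) : LvT.val n₁ n₂ n₃ A ≠ LvT.val n₁ n₂ n₃ B := by
  unfold neQ at h
  by_cases he : A.1 = B.1
  · rw [if_pos he] at h
    by_cases hl : A.2 ≠ B.2
    · unfold LvT.val; rw [he]; omega
    · rw [if_neg hl] at h; unfold falseQ evalQ evalC at h; simp at h
  · rw [if_neg he] at h
    unfold evalQ evalC at h
    simp only [List.all_cons, List.all_nil, List.any_cons, List.any_nil, Bool.or_false, Bool.and_true, Bool.or_eq_true] at h
    rcases h with h | h
    · have := dgtAtom_sound h1 h2 h3 hA hB he h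
      unfold LvT.val at this ⊢; simp only [add_zero] at this; omega
    · have := dgtAtom_sound h1 h2 h3 hB hA (Ne.symm he) h
      unfold LvT.val at this ⊢; simp only [add_zero] at this; omega

omit h1 h2 h3 in
/-- `evalQ` of an append. [folklore] -/
theorem evalQ_append (p : Pat) (q q' : List (List Atom)) : evalQ p (q ++ q') = (evalQ p q && evalQ p q') := by
  unfold evalQ; rw [List.all_append]

/-- Soundness of `ltMinQ`: `A < B` for every `B ∈ Bs`. [folklore] -/
theorem ltMinQ_sound {A : LvT} {Bs : List LvT} (hA : A.1 = 1 ∨ A.1 = 2 ∨ A.1 = 3) (hBs : ∀ B ∈ Bs, B.1 = 1 ∨ B.1 = 2 ∨ B.1 = 3)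
    (h : evalQ (patOf n₁ n₂ n₃ k) (ltMinQ A Bs) = true) : ∀ B ∈ Bs, LvT.val n₁ n₂ n₃ A < LvT.val n₁ n₂ n₃ B := by
  intro B hB
  unfold ltMinQ evalQ at h
  rw [List.all_eq_true] at h
  refine ltQ_sound h1 h2 h3 hA (hBs B hB) ?_
  unfold evalQ; rw [List.all_eq_true]
  intro c hc; exact h c (List.mem_flatMap.2 ⟨B, hB, hc⟩)

/-- Soundness of `gtMaxQ`: `B < A` for every `B ∈ Bs`. [folklore] -/
theorem gtMaxQ_sound {A : LvT} {Bs : List LvT} (hA : A.1 = 1 ∨ A.1 = 2 ∨ A.1 = 3) (hBs : ∀ B ∈ Bs, B.1 = 1 ∨ B.1 = 2 ∨ B.1 = 3)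
    (h : evalQ (patOf n₁ n₂ n₃ k) (gtMaxQ A Bs) = true) : ∀ B ∈ Bs, LvT.val n₁ n₂ n₃ B < LvT.val n₁ n₂ n₃ A := by
  intro B hB
  unfold gtMaxQ evalQ at h
  rw [List.all_eq_true] at h
  refine ltQ_sound h1 h2 h3 (hBs B hB) hA ?_
  unfold evalQ; rw [List.all_eq_true]
  intro c hc; exact h c (List.mem_flatMap.2 ⟨B, hB, hc⟩)

omit h1 h2 h3 in
/-- The boundary atoms are well-sorted. [folklore] -/
theorem ws_bdry {i : ℕ} (hi : i = 1 ∨ i = 2 ∨ i = 3) (x : ℤ) :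
    (ge0A i x).ws = true ∧ (leKA i x).ws = true ∧ (ne0A i x).ws = true ∧ (neKA i x).ws = true ∧ (eq0A i x).ws = true ∧ (eqKA i x).ws = true := by
  rcases hi with rfl | rfl | rfl <;> simp [ge0A, leKA, ne0A, neKA, eq0A, eqKA, botC, topC, Atom.ws]

omit h1 h2 h3 in
/-- The real quantities behind the boundary coordinates of terminal `i`. [folklore] -/
theorem realOf_bdry {i : ℕ} (hi : i = 1 ∨ i = 2 ∨ i = 3) :
    realOf n₁ n₂ n₃ k (botC i) = LvT.val n₁ n₂ n₃ (i, 0) ∧ realOf n₁ n₂ n₃ k (topC i) = k - LvT.val n₁ n₂ n₃ (i, 0) := by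
  rcases hi with rfl | rfl | rfl <;> simp [botC, topC, realOf, LvT.val]

/-- Soundness of the single boundary atoms. [folklore] -/
theorem bdry_sound {i : ℕ} (hi : i = 1 ∨ i = 2 ∨ i = 3) (x : ℤ) :
    ((ge0A i x).eval (patOf n₁ n₂ n₃ k) = true → 0 ≤ LvT.val n₁ n₂ n₃ (i, x)) ∧
    ((leKA i x).eval (patOf n₁ n₂ n₃ k) = true → LvT.val n₁ n₂ n₃ (i, x) ≤ k) ∧
    ((ne0A i x).eval (patOf n₁ n₂ n₃ k) = true → LvT.val n₁ n₂ n₃ (i, x) ≠ 0) ∧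
    ((neKA i x).eval (patOf n₁ n₂ n₃ k) = true → LvT.val n₁ n₂ n₃ (i, x) ≠ k) ∧
    ((eq0A i x).eval (patOf n₁ n₂ n₃ k) = true → LvT.val n₁ n₂ n₃ (i, x) = 0) ∧
    ((eqKA i x).eval (patOf n₁ n₂ n₃ k) = true → LvT.val n₁ n₂ n₃ (i, x) = k) := by
  obtain ⟨w1, w2, w3, w4, w5, w6⟩ := ws_bdry hi x
  obtain ⟨rb, rt⟩ := realOf_bdry (n₁ := n₁) (n₂ := n₂) (n₃ := n₃) (k := k) hi
  have vx : LvT.val n₁ n₂ n₃ (i, x) = LvT.val n₁ n₂ n₃ (i, 0) + x := by unfold LvT.val; simp only; ring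
  refine ⟨fun h => ?_, fun h => ?_, fun h => ?_, fun h => ?_, fun h => ?_, fun h => ?_⟩
  · have s := Atom.sound _ w1 h1 h2 h3 h; unfold Atom.Means ge0A at s; simp only at s; rw [rb] at s; omega
  · have s := Atom.sound _ w2 h1 h2 h3 h; unfold Atom.Means leKA at s; simp only at s; rw [rt] at s; omega
  · have s := Atom.sound _ w3 h1 h2 h3 h; unfold Atom.Means ne0A at s; simp only at s; rw [rb] at s; omega
  · have s := Atom.sound _ w4 h1 h2 h3 h; unfold Atom.Means neKA at s; simp only at s; rw [rt] at s; omega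
  · have s := Atom.sound _ w5 h1 h2 h3 h; unfold Atom.Means eq0A at s; simp only at s; rw [rb] at s; omega
  · have s := Atom.sound _ w6 h1 h2 h3 h; unfold Atom.Means eqKA at s; simp only at s; rw [rt] at s; omega

omit h1 h2 h3 in
/-- A cube of single-atom clauses holds iff all the atoms hold. [folklore] -/
theorem evalQ_singletons (p : Pat) (as : List Atom) : evalQ p (as.map fun a => [a]) = as.all (Atom.eval p) := by
  induction as with
  | nil => rfl
  | cons a as ih =>
    unfold evalQ at ih ⊢
    simp only [List.map_cons, List.all_cons, evalC, List.any_cons, List.any_nil, Bool.or_false, ih]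

/-- Soundness of `memQ`: the level `nᵢ + x` is in `[0, k]`, is `≠ 0` if `bb`, and `≠ k` if `bt`. [folklore] -/
theorem memQ_sound {i : ℕ} (hi : i = 1 ∨ i = 2 ∨ i = 3) {x : ℤ} {bb bt : Bool} (h : evalQ (patOf n₁ n₂ n₃ k) (memQ i x bb bt) = true) :
    0 ≤ LvT.val n₁ n₂ n₃ (i, x) ∧ LvT.val n₁ n₂ n₃ (i, x) ≤ k ∧ (bb = true → LvT.val n₁ n₂ n₃ (i, x) ≠ 0) ∧
      (bt = true → LvT.val n₁ n₂ n₃ (i, x) ≠ k) := by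
  obtain ⟨s1, s2, s3, s4, -, -⟩ := bdry_sound h1 h2 h3 hi x
  unfold memQ at h
  rw [evalQ_append, evalQ_append, Bool.and_eq_true, Bool.and_eq_true] at h
  obtain ⟨⟨hA, hB⟩, hC⟩ := h
  have eA : evalQ (patOf n₁ n₂ n₃ k) [[ge0A i x], [leKA i x]] = ((ge0A i x).eval (patOf n₁ n₂ n₃ k) && (leKA i x).eval (patOf n₁ n₂ n₃ k)) := by
    unfold evalQ evalC; simp
  rw [eA, Bool.and_eq_true] at hA
  refine ⟨s1 hA.1, s2 hA.2, fun hbb => ?_, fun hbt => ?_⟩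
  · rw [hbb, if_pos rfl] at hB
    have eB : evalQ (patOf n₁ n₂ n₃ k) [[ne0A i x]] = (ne0A i x).eval (patOf n₁ n₂ n₃ k) := by unfold evalQ evalC; simp
    rw [eB] at hB; exact s3 hB
  · rw [hbt, if_pos rfl] at hC
    have eC : evalQ (patOf n₁ n₂ n₃ k) [[neKA i x]] = (neKA i x).eval (patOf n₁ n₂ n₃ k) := by unfold evalQ evalC; simp
    rw [eC] at hC; exact s4 hC

end Sound

end Slab111

end Summit.CriticalPhenomena.PercolationContinuityZ3.Theorems.Transplant
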